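import Summits.SmoothPoincare4.SmoothPoincare4.Theorems.SymplecticOrigamiGromovRecognitionRelEndStubCapModelCap4

/-!
# Wedge cap for `GromovRecognitionRelEnd` — coordinates on the cap; the end hypotheses
(stub `stub_capModel` of line `cross-cap-laurent`, crux `SymplecticOrigami.GromovRecognitionRelEnd`,
item stmt-SmoothPoincare4-11009)

* `EndHyp`: the hypotheses of the stub (the ten end hypotheses of the crux, Stub 1's openness of
  the truncations, and Stub 2's tame `J` standard beyond `R₁`), bundled; first consequences
  (`K` is closed, `χ` inverts `ψ`, smoothness at points).
* `ofCoord w : Cap R₁` — the point of the cap with affine coordinates `w ∈ ℂ²` (meaningful when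
  `|z₁| > R₁` or `|z₂| > R₁`), through the `V`-chart `(1/z₁, z₂)` or the `H`-chart `(z₁, 1/z₂)`
  (consistently); `coord : Cap R₁ → ℂ²`, its inverse on the finite part; the three chart
  embeddings `κV, κH, κC` of the pieces into the cap and how `coord` reads them.
-/

noncomputable section

-- the registered namespace `Summit.SmoothPoincare4.SmoothPoincare4.Theorems…` repeats a component
set_option linter.dupNamespace false

open scoped Manifold ContDiff Topology
open Set Function Filter TopologicalSpace Literature.Geometry.Kaehler Literature.Geometry.Symplectic
  Literature.Topology.FourManifolds

namespace Summit.SmoothPoincare4.SmoothPoincare4.Theorems.GromovRecognitionRelEnd.CrossCapLaurent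

namespace CapModel

/-- Model space `ℝ⁴ = ℂ²` (coordinates `0,1` = `z₁`, `2,3` = `z₂`). -/
local notation "E4" => EuclideanSpace ℝ (Fin 4)

/-! ## The hypotheses of the stub, bundled -/

/-- **The hypotheses of `stub_capModel`**: the end hypotheses of the crux for `(M, sf, K, R, ψ, χ)`,
the openness of the truncations (Stub 1) and a tame almost complex structure `J` equal to
`ψ*(i ⊕ i)` beyond `R₁ > max R 0` (Stub 2); a record of proofs (data-free), used only to shorten
the signatures of the lemmas of this construction. [folklore] -/
structure EndHyp {M : Type} [TopologicalSpace M] [ChartedSpace E4 M] [IsManifold (𝓡 4) ∞ M]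
    (sf : MForm (𝓡 4) M ℝ 2) (K : Set M) (R : ℝ) (ψ : M → E4) (χ : E4 → M) (R₁ : ℝ)
    (J : AlmostComplexStructure (𝓡 4) ∞ M) : Type where
  /-- H2 -/
  smooth : IsSmoothForm sf
  /-- H3 -/
  closed : IsClosedForm sf
  /-- H4 -/
  nondeg : ∀ x (v : TangentSpace (𝓡 4) x), v ≠ 0 → ∃ w, sf x ![v, w] ≠ 0
  /-- H5 -/
  ends : ∀ R', R ≤ R' → IsCompact (K ∪ {x | ‖ψ x‖ ≤ R'})
  /-- H6 -/
  smooth_ψ : ContMDiffOn (𝓡 4) 𝓘(ℝ, E4) ∞ ψ Kᶜ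
  /-- H7 -/
  smooth_χ : ContMDiffOn 𝓘(ℝ, E4) (𝓡 4) ∞ χ (Metric.closedBall (0 : E4) R)ᶜ
  /-- H8 -/
  bij : Set.BijOn ψ Kᶜ (Metric.closedBall (0 : E4) R)ᶜ
  /-- H9 -/
  left_inv : ∀ x, x ∈ Kᶜ → χ (ψ x) = x
  /-- H10 -/
  pullback_eq : ∀ x, x ∈ Kᶜ → ∀ v w, sf x ![v, w] =
    stdSymplecticForm (mfderiv (𝓡 4) 𝓘(ℝ, E4) ψ x v) (mfderiv (𝓡 4) 𝓘(ℝ, E4) ψ x w)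
  /-- Stub 1 -/
  isOpen_trunc : ∀ R', R < R' → IsOpen (K ∪ {x | x ∈ Kᶜ ∧ ‖ψ x‖ < R'})
  /-- `R < R₁` -/
  lt_R₁ : R < R₁
  /-- `0 < R₁` -/
  R₁_pos : 0 < R₁
  /-- Stub 2: tameness -/
  tame : J.IsTamedBy sf
  /-- Stub 2: `J = ψ*(i⊕i)` beyond `R₁` -/
  Jstd : ∀ x, x ∈ Kᶜ → R₁ < ‖ψ x‖ → ∀ (v : TangentSpace (𝓡 4) x) (a : E4),
    a = mfderiv (𝓡 4) 𝓘(ℝ, E4) ψ x v →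
    mfderiv (𝓡 4) 𝓘(ℝ, E4) ψ x (J x v) = WithLp.toLp 2 ![-(a 1), a 0, -(a 3), a 2]

namespace EndHyp

variable {M : Type} [TopologicalSpace M] [ChartedSpace E4 M] [IsManifold (𝓡 4) ∞ M]
  {sf : MForm (𝓡 4) M ℝ 2} {K : Set M} {R : ℝ} {ψ : M → E4} {χ : E4 → M} {R₁ : ℝ}
  {J : AlmostComplexStructure (𝓡 4) ∞ M} (H : EndHyp sf K R ψ χ R₁ J)
include H

/-- Points of the end have `R < ‖ψ x‖`. [folklore] -/
theorem lt_norm_ψ {x : M} (hx : x ∈ Kᶜ) : R < ‖ψ x‖ := by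
  have h := H.bij.mapsTo hx
  simpa [Metric.mem_closedBall, dist_zero_right] using h

/-- `K` is closed (a point of `closure K ∖ K` would lie in the end and in the compact
`K ∪ {‖ψ‖ ≤ R}`; copy of Disproof `isClosed_of_endsCoCompact`). [folklore] -/
theorem isClosed_K [T2Space M] : IsClosed K := by
  -- adapted from Cruxes/GromovRecognitionRelEnd/Disproof.lean (isClosed_of_endsCoCompact)
  have hC : IsClosed (K ∪ {x | ‖ψ x‖ ≤ R}) := (H.ends R le_rfl).isClosed
  rw [← closure_subset_iff_isClosed]
  intro x hx
  have hxC : x ∈ K ∪ {x | ‖ψ x‖ ≤ R} := closure_minimal subset_union_left hC hx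
  rcases hxC with hxK | hxR
  · exact hxK
  · by_contra hxK
    exact absurd hxR (not_le.2 (H.lt_norm_ψ hxK))

/-- `Kᶜ` is open. [folklore] -/
theorem isOpen_compl_K [T2Space M] : IsOpen Kᶜ := H.isClosed_K.isOpen_compl

/-- For `R < ‖w‖`: `χ w ∈ Kᶜ` and `ψ (χ w) = w`. [folklore] -/
theorem χ_spec {w : E4} (hw : R < ‖w‖) : χ w ∈ Kᶜ ∧ ψ (χ w) = w := by
  have hw' : w ∈ (Metric.closedBall (0 : E4) R)ᶜ := by
    simpa [Metric.mem_closedBall, dist_zero_right] using hw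
  obtain ⟨x, hx, rfl⟩ := H.bij.surjOn hw'
  rw [H.left_inv x hx]
  exact ⟨hx, rfl⟩

/-- `ψ` is `C^∞` at the points of the end. [folklore] -/
theorem contMDiffAt_ψ [T2Space M] {x : M} (hx : x ∈ Kᶜ) : ContMDiffAt (𝓡 4) 𝓘(ℝ, E4) ∞ ψ x :=
  (H.smooth_ψ x hx).contMDiffAt (H.isOpen_compl_K.mem_nhds hx)

/-- `χ` is `C^∞` at the points beyond `R`. [folklore] -/
theorem contMDiffAt_χ {w : E4} (hw : R < ‖w‖) : ContMDiffAt 𝓘(ℝ, E4) (𝓡 4) ∞ χ w := by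
  have hw' : w ∈ (Metric.closedBall (0 : E4) R)ᶜ := by
    simpa [Metric.mem_closedBall, dist_zero_right] using hw
  exact (H.smooth_χ w hw').contMDiffAt (Metric.isClosed_closedBall.isOpen_compl.mem_nhds hw')

/-- `R₁² < |z₁|²` puts a point beyond `R₁`, hence beyond `R`. [folklore] -/
theorem lt_norm_of_r1 {w : E4} (h : R₁ ^ 2 < r1 w) : R₁ < ‖w‖ ∧ R < ‖w‖ :=
  ⟨lt_norm_of_sq_lt_r1 h, H.lt_R₁.trans (lt_norm_of_sq_lt_r1 h)⟩

/-- `R₁² < |z₂|²` puts a point beyond `R₁`, hence beyond `R`. [folklore] -/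
theorem lt_norm_of_r2 {w : E4} (h : R₁ ^ 2 < r2 w) : R₁ < ‖w‖ ∧ R < ‖w‖ :=
  ⟨lt_norm_of_sq_lt_r2 h, H.lt_R₁.trans (lt_norm_of_sq_lt_r2 h)⟩

/-- **Bounded-coordinate neighbourhoods** (the use of Stub 1): every point of `M` has a
neighbourhood on which the end coordinate is bounded. [folklore] -/
theorem exists_nhds_norm_ψ_lt (x : M) : ∃ N ∈ 𝓝 x, ∃ R' : ℝ, ∀ x' ∈ N, x' ∈ Kᶜ → ‖ψ x'‖ < R' := by
  set R' : ℝ := max (R + 1) (‖ψ x‖ + 1)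
  have hR' : R < R' := lt_of_lt_of_le (lt_add_one R) (le_max_left _ _)
  refine ⟨K ∪ {x' | x' ∈ Kᶜ ∧ ‖ψ x'‖ < R'}, (H.isOpen_trunc R' hR').mem_nhds ?_, R', ?_⟩
  · by_cases hx : x ∈ K
    · exact Or.inl hx
    · exact Or.inr ⟨hx, lt_of_lt_of_le (lt_add_one _) (le_max_right _ _)⟩
  · rintro x' (hK | ⟨-, h⟩) hx'
    · exact absurd hK hx'
    · exact h

end EndHyp

/-! ## The three chart embeddings into the cap; affine coordinates -/

variable {R₁ : ℝ} [hR : Fact (0 < R₁)]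

/-- The `V`-chart in the cap. [folklore] -/
abbrev κV : OV R₁ → Cap R₁ := (dC1 R₁).inl ∘ jV₁
/-- The `H`-chart in the cap. [folklore] -/
abbrev κH : OH R₁ → Cap R₁ := (dC1 R₁).inl ∘ jH₁
/-- The corner chart in the cap. [folklore] -/
abbrev κC : OC R₁ → Cap R₁ := (dC1 R₁).inr

/-- **The point of the cap with affine coordinates `w`** (junk unless `|z₁| > R₁` or `|z₂| > R₁`).
[folklore] -/
def ofCoord (w : E4) : Cap R₁ :=
  open scoped Classical in
  if R₁ ^ 2 < r1 w then κV (mkV (inv1 w)) else κH (mkH (inv2 w))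

omit hR in
/-- `inv1 w ∈ OV` off the axis when... always: `|1/z₁|² < R₁⁻²` iff `R₁² < |z₁|²`. [folklore] -/
theorem inv1_mem_OV {w : E4} (h : R₁ ^ 2 < r1 w) (hR' : 0 < R₁) : inv1 w ∈ OV R₁ := r1_inv1_lt hR' h

/-- The two chart descriptions of a point with both coordinates beyond `R₁` agree. [folklore] -/
theorem κV_mkV_inv1_eq {w : E4} (h1 : R₁ ^ 2 < r1 w) (h2 : R₁ ^ 2 < r2 w) :
    κV (mkV (inv1 w)) = (κH (mkH (inv2 w)) : Cap R₁) := by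
  have h1' := r1_ne_zero_of_sq_lt h1
  have hm : inv1 w ∈ OV R₁ := r1_inv1_lt hR.out h1
  show (dC1 R₁).inl (jV₁ (mkV (inv1 w))) = (dC1 R₁).inl (jH₁ (mkH (inv2 w)))
  congr 1
  rw [jV₁_eq_jH₁_iff, mkV, val_toOpens hm, r1_inv1, r2_inv1]
  exact ⟨⟨inv_ne_zero h1', h2⟩, by rw [inv12, inv1_inv1 h1']⟩

/-- `ofCoord` through the `V`-chart. [folklore] -/
theorem ofCoord_of_r1 {w : E4} (h1 : R₁ ^ 2 < r1 w) : ofCoord w = (κV (mkV (inv1 w)) : Cap R₁) := by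
  simp only [ofCoord, h1, if_true]

/-- `ofCoord` through the `H`-chart. [folklore] -/
theorem ofCoord_of_r2 {w : E4} (h2 : R₁ ^ 2 < r2 w) : ofCoord w = (κH (mkH (inv2 w)) : Cap R₁) := by
  by_cases h1 : R₁ ^ 2 < r1 w
  · rw [ofCoord_of_r1 h1, κV_mkV_inv1_eq h1 h2]
  · simp only [ofCoord, h1, if_false]

/-- `ofCoord` is `C^∞` at the points with `|z₁| > R₁`. [folklore] -/
theorem contMDiffAt_ofCoord_of_r1 {w : E4} (h1 : R₁ ^ 2 < r1 w) :
    ContMDiffAt 𝓘(ℝ, E4) 𝓘(ℝ, E4) ∞ (ofCoord : E4 → Cap R₁) w := by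
  have hev : (ofCoord : E4 → Cap R₁) =ᶠ[𝓝 w] κV ∘ toOpens (OV R₁) oV ∘ inv1 := by
    filter_upwards [(isOpen_lt continuous_const continuous_r1).mem_nhds h1] with w' hw'
    exact ofCoord_of_r1 hw'
  refine ContMDiffAt.congr_of_eventuallyEq ?_ hev
  exact (((dC1 R₁).contMDiff_inl _).comp _ ((dVH R₁).contMDiff_inl _)).comp w
    ((contMDiffAt_toOpens (r1_inv1_lt hR.out h1)).comp w (contDiffAt_inv1 (r1_ne_zero_of_sq_lt h1)).contMDiffAt)

/-- `ofCoord` is `C^∞` at the points with `|z₂| > R₁`. [folklore] -/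
theorem contMDiffAt_ofCoord_of_r2 {w : E4} (h2 : R₁ ^ 2 < r2 w) :
    ContMDiffAt 𝓘(ℝ, E4) 𝓘(ℝ, E4) ∞ (ofCoord : E4 → Cap R₁) w := by
  have hev : (ofCoord : E4 → Cap R₁) =ᶠ[𝓝 w] κH ∘ toOpens (OH R₁) oH ∘ inv2 := by
    filter_upwards [(isOpen_lt continuous_const continuous_r2).mem_nhds h2] with w' hw'
    exact ofCoord_of_r2 hw'
  refine ContMDiffAt.congr_of_eventuallyEq ?_ hev
  exact (((dC1 R₁).contMDiff_inl _).comp _ ((dVH R₁).contMDiff_inr _)).comp w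
    ((contMDiffAt_toOpens (r2_inv2_lt hR.out h2)).comp w (contDiffAt_inv2 (r2_ne_zero_of_sq_lt h2)).contMDiffAt)

/-- **The affine coordinates of a point of the cap** (junk on the wedge). [folklore] -/
def coord (y : Cap R₁) : E4 :=
  open scoped Classical in
  if y ∈ range (κV : OV R₁ → Cap R₁) then inv1 (invFun (κV : OV R₁ → Cap R₁) y).1
  else if y ∈ range (κH : OH R₁ → Cap R₁) then inv2 (invFun (κH : OH R₁ → Cap R₁) y).1
  else inv12 (invFun (κC : OC R₁ → Cap R₁) y).1

/-- `κV` is injective. [folklore] -/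
theorem κV_injective : Injective (κV : OV R₁ → Cap R₁) :=
  (dC1 R₁).inl_injective.comp (dVH R₁).inl_injective
/-- `κH` is injective. [folklore] -/
theorem κH_injective : Injective (κH : OH R₁ → Cap R₁) :=
  (dC1 R₁).inl_injective.comp (dVH R₁).inr_injective

/-- `coord` on the `V`-chart is `(1/u, z₂)`. [folklore] -/
theorem coord_κV (b : OV R₁) : coord (κV b) = inv1 b.1 := by
  simp only [coord, mem_range_self, if_true, invFun_apply κV_injective]

/-- `κH b = κV b'` forces the `VH`-identification. [folklore] -/
theorem κH_eq_κV_iff {b : OH R₁} {b' : OV R₁} :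
    κH b = κV b' ↔ (r1 b'.1 ≠ 0 ∧ R₁ ^ 2 < r2 b'.1) ∧ mkH (inv12 b'.1) = b := by
  rw [show κH b = (dC1 R₁).inl (jH₁ b) from rfl, show κV b' = (dC1 R₁).inl (jV₁ b') from rfl,
    (dC1 R₁).inl_injective.eq_iff, eq_comm, jV₁_eq_jH₁_iff]

/-- `coord` on the `H`-chart is `(z₁, 1/t)`. [folklore] -/
theorem coord_κH (b : OH R₁) : coord (κH b) = inv2 b.1 := by
  by_cases h : (κH b : Cap R₁) ∈ range (κV : OV R₁ → Cap R₁)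
  · obtain ⟨b', hb'⟩ := h
    obtain ⟨⟨h1, h2⟩, hbb⟩ := κH_eq_κV_iff.1 hb'.symm
    rw [← hb', coord_κV, ← hbb, mkH, val_toOpens (inv12_mapsV b'.2 h1 h2).1,
      inv2_inv12 (r2_ne_zero_of_sq_lt h2)]
  · simp only [coord, h, if_false, mem_range_self, if_true, invFun_apply κH_injective]

/-- `κC c = κV b'` forces the corner identification through the `V`-chart. [folklore] -/
theorem κC_eq_κV_iff {c : OC R₁} {b' : OV R₁} :
    κC c = κV b' ↔ R₁ ^ 2 < r2 b'.1 ∧ mkC (inv2 b'.1) = c := by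
  rw [show κV b' = (dC1 R₁).inl (jV₁ b') from rfl, eq_comm, (dC1 R₁).inl_eq_inr_iff,
    jV₁_mem_source_iff, dC1_glue, glueC_apply, gC_jV₁]

/-- `κC c = κH b'` forces the corner identification through the `H`-chart. [folklore] -/
theorem κC_eq_κH_iff {c : OC R₁} {b' : OH R₁} :
    κC c = κH b' ↔ R₁ ^ 2 < r1 b'.1 ∧ mkC (inv1 b'.1) = c := by
  rw [show κH b' = (dC1 R₁).inl (jH₁ b') from rfl, eq_comm, (dC1 R₁).inl_eq_inr_iff,
    jH₁_mem_source_iff, dC1_glue, glueC_apply, gC_jH₁]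

/-- `coord` on the corner chart is `(1/u, 1/t)`. [folklore] -/
theorem coord_κC (c : OC R₁) : coord (κC c) = inv12 c.1 := by
  by_cases hV : (κC c : Cap R₁) ∈ range (κV : OV R₁ → Cap R₁)
  · obtain ⟨b', hb'⟩ := hV
    obtain ⟨h2, hcc⟩ := κC_eq_κV_iff.1 hb'.symm
    rw [← hb', coord_κV, ← hcc, mkC, val_toOpens (inv2_mapsV b'.2 h2).1, inv12, ← inv1_inv2,
      inv2_inv2 (r2_ne_zero_of_sq_lt h2)]
  by_cases hH : (κC c : Cap R₁) ∈ range (κH : OH R₁ → Cap R₁)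
  · obtain ⟨b', hb'⟩ := hH
    obtain ⟨h1, hcc⟩ := κC_eq_κH_iff.1 hb'.symm
    rw [← hb', coord_κH, ← hcc, mkC, val_toOpens (inv1_mapsH b'.2 h1).1, inv12,
      inv1_inv1 (r1_ne_zero_of_sq_lt h1)]
  · simp only [coord, hV, hH, if_false, invFun_apply (dC1 R₁).inr_injective]

/-- **`coord ∘ ofCoord = id`** on the admissible coordinates. [folklore] -/
theorem coord_ofCoord {w : E4} (hw : R₁ ^ 2 < r1 w ∨ R₁ ^ 2 < r2 w) : coord (ofCoord w : Cap R₁) = w := by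
  rcases hw with h1 | h2
  · rw [ofCoord_of_r1 h1, coord_κV, mkV, val_toOpens (r1_inv1_lt hR.out h1),
      inv1_inv1 (r1_ne_zero_of_sq_lt h1)]
  · rw [ofCoord_of_r2 h2, coord_κH, mkH, val_toOpens (r2_inv2_lt hR.out h2),
      inv2_inv2 (r2_ne_zero_of_sq_lt h2)]

/-- A `V`-chart point off the axis is the point with coordinates `(1/u, z₂)`. [folklore] -/
theorem κV_eq_ofCoord {b : OV R₁} (h : r1 b.1 ≠ 0) : κV b = (ofCoord (inv1 b.1) : Cap R₁) := by
  rw [ofCoord_of_r1 (sq_lt_r1_inv1 h b.2)]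
  congr 1
  apply Subtype.ext
  rw [mkV, val_toOpens (by rw [inv1_inv1 h]; exact b.2), inv1_inv1 h]

/-- An `H`-chart point off the axis is the point with coordinates `(z₁, 1/t)`. [folklore] -/
theorem κH_eq_ofCoord {b : OH R₁} (h : r2 b.1 ≠ 0) : κH b = (ofCoord (inv2 b.1) : Cap R₁) := by
  rw [ofCoord_of_r2 (sq_lt_r2_inv2 h b.2)]
  congr 1
  apply Subtype.ext
  rw [mkH, val_toOpens (by rw [inv2_inv2 h]; exact b.2), inv2_inv2 h]

/-- `coord` is `C^∞` at the `V`-chart points off the axis. [folklore] -/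
theorem contMDiffAt_coord_κV {b : OV R₁} (h : r1 b.1 ≠ 0) :
    ContMDiffAt 𝓘(ℝ, E4) 𝓘(ℝ, E4) ∞ (coord : Cap R₁ → E4) (κV b) := by
  have hemb : Manifold.IsSmoothEmbedding 𝓘(ℝ, E4) 𝓘(ℝ, E4) ∞ (κV : OV R₁ → Cap R₁) :=
    (dC1 R₁).isSmoothEmbedding_inl_comp (dVH R₁).isSmoothEmbedding_inl
  have hop : IsOpen (range (κV : OV R₁ → Cap R₁)) := by
    rw [range_comp]; exact (dC1 R₁).isOpenMap_inl _ (dVH R₁).isOpen_range_inl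
  have hev : (coord : Cap R₁ → E4) =ᶠ[𝓝 (κV b)] (inv1 ∘ Subtype.val) ∘ invFun (κV : OV R₁ → Cap R₁) := by
    filter_upwards [hop.mem_nhds (mem_range_self b)] with y hy
    obtain ⟨b', rfl⟩ := hy
    show coord (κV b') = inv1 (invFun (κV : OV R₁ → Cap R₁) (κV b')).1
    rw [coord_κV, invFun_apply κV_injective]
  refine ContMDiffAt.congr_of_eventuallyEq ?_ hev
  refine ContMDiffAt.comp (κV b) ?_ (contMDiffAt_invFun hemb hop (mem_range_self b))
  rw [invFun_apply κV_injective]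
  exact (contDiffAt_inv1 h).contMDiffAt.comp b contMDiff_subtype_val.contMDiffAt

/-- `coord` is `C^∞` at the `H`-chart points off the axis. [folklore] -/
theorem contMDiffAt_coord_κH {b : OH R₁} (h : r2 b.1 ≠ 0) :
    ContMDiffAt 𝓘(ℝ, E4) 𝓘(ℝ, E4) ∞ (coord : Cap R₁ → E4) (κH b) := by
  have hemb : Manifold.IsSmoothEmbedding 𝓘(ℝ, E4) 𝓘(ℝ, E4) ∞ (κH : OH R₁ → Cap R₁) :=
    (dC1 R₁).isSmoothEmbedding_inl_comp (dVH R₁).isSmoothEmbedding_inr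
  have hop : IsOpen (range (κH : OH R₁ → Cap R₁)) := by
    rw [range_comp]; exact (dC1 R₁).isOpenMap_inl _ (dVH R₁).isOpen_range_inr
  have hev : (coord : Cap R₁ → E4) =ᶠ[𝓝 (κH b)] (inv2 ∘ Subtype.val) ∘ invFun (κH : OH R₁ → Cap R₁) := by
    filter_upwards [hop.mem_nhds (mem_range_self b)] with y hy
    obtain ⟨b', rfl⟩ := hy
    show coord (κH b') = inv2 (invFun (κH : OH R₁ → Cap R₁) (κH b')).1
    rw [coord_κH, invFun_apply κH_injective]
  refine ContMDiffAt.congr_of_eventuallyEq ?_ hev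
  refine ContMDiffAt.comp (κH b) ?_ (contMDiffAt_invFun hemb hop (mem_range_self b))
  rw [invFun_apply κH_injective]
  exact (contDiffAt_inv2 h).contMDiffAt.comp b contMDiff_subtype_val.contMDiffAt

end CapModel

/-- **Registered helper sub-goal `helper_capModelEndFacts`** (file `X1` of stub `stub_capModel`): under the
hypotheses of the stub, the first consequences of the end hypotheses — `K` is closed and `χ` inverts `ψ` beyond `R`. [folklore] -/
theorem helper_capModelEndFacts :
    ∀ (M : Type) [TopologicalSpace M] [T2Space M] [SecondCountableTopology M]
      [ChartedSpace (EuclideanSpace ℝ (Fin 4)) M] [IsManifold (𝓡 4) ∞ M] [ConnectedSpace M]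
      (sf : Literature.Geometry.Kaehler.MForm (𝓡 4) M ℝ 2) (K : Set M) (R : ℝ)
      (ψ : M → EuclideanSpace ℝ (Fin 4)) (χ : EuclideanSpace ℝ (Fin 4) → M),
      Literature.Geometry.Kaehler.IsSmoothForm sf → Literature.Geometry.Kaehler.IsClosedForm sf →
      (∀ x (v : TangentSpace (𝓡 4) x), v ≠ 0 → ∃ w, sf x ![v, w] ≠ 0) →
      (∀ R', R ≤ R' → IsCompact (K ∪ {x | ‖ψ x‖ ≤ R'})) →
      ContMDiffOn (𝓡 4) 𝓘(ℝ, EuclideanSpace ℝ (Fin 4)) ∞ ψ Kᶜ →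
      ContMDiffOn 𝓘(ℝ, EuclideanSpace ℝ (Fin 4)) (𝓡 4) ∞ χ
        (Metric.closedBall (0 : EuclideanSpace ℝ (Fin 4)) R)ᶜ →
      Set.BijOn ψ Kᶜ (Metric.closedBall (0 : EuclideanSpace ℝ (Fin 4)) R)ᶜ →
      (∀ x, x ∈ Kᶜ → χ (ψ x) = x) →
      (∀ x, x ∈ Kᶜ → ∀ v w, sf x ![v, w] = Literature.Geometry.Symplectic.stdSymplecticForm
        (mfderiv (𝓡 4) 𝓘(ℝ, EuclideanSpace ℝ (Fin 4)) ψ x v)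
        (mfderiv (𝓡 4) 𝓘(ℝ, EuclideanSpace ℝ (Fin 4)) ψ x w)) →
      (∀ R', R < R' → IsOpen (K ∪ {x | x ∈ Kᶜ ∧ ‖ψ x‖ < R'})) →
      ∀ (R₁ : ℝ) (J : Literature.Geometry.Symplectic.AlmostComplexStructure (𝓡 4) ∞ M),
      R < R₁ → 0 < R₁ → J.IsTamedBy sf →
      (∀ x, x ∈ Kᶜ → R₁ < ‖ψ x‖ → ∀ (v : TangentSpace (𝓡 4) x) (a : EuclideanSpace ℝ (Fin 4)),
          a = mfderiv (𝓡 4) 𝓘(ℝ, EuclideanSpace ℝ (Fin 4)) ψ x v →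
          mfderiv (𝓡 4) 𝓘(ℝ, EuclideanSpace ℝ (Fin 4)) ψ x (J x v) =
            WithLp.toLp 2 ![-(a 1), a 0, -(a 3), a 2]) →
      IsClosed K ∧ ∀ w : EuclideanSpace ℝ (Fin 4), R < ‖w‖ → χ w ∈ Kᶜ ∧ ψ (χ w) = w := by
  intro M _ _ _ _ _ _ sf K R ψ χ h2 h3 h4 h5 h6 h7 h8 h9 h10 hopen R₁ J hR₁ hR₁pos hJt hJstd
  haveI : Fact (0 < R₁) := ⟨hR₁pos⟩
  let H : CapModel.EndHyp sf K R ψ χ R₁ J :=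
    { smooth := h2, closed := h3, nondeg := h4, ends := h5, smooth_ψ := h6, smooth_χ := h7, bij := h8,
      left_inv := h9, pullback_eq := h10, isOpen_trunc := hopen, lt_R₁ := hR₁, R₁_pos := hR₁pos,
      tame := hJt, Jstd := hJstd }
  exact ⟨H.isClosed_K, fun w hw => H.χ_spec hw⟩

end Summit.SmoothPoincare4.SmoothPoincare4.Theorems.GromovRecognitionRelEnd.CrossCapLaurent
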